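import Summits.Ventures.Crystal3D.Theorems.StickyWulffConstantCoaxialWallLawModelNormals
import Summits.Ventures.Crystal3D.Theorems.StickyWulffConstantCoaxialWallLawNonReturn
import Summits.Ventures.Crystal3D.Theorems.StickyWulffConstantGenericWallFloorCubicCoords
import Summits.Ventures.Crystal3D.Theorems.StickyWulffConstantGenericWallFloorTwinFrame
import HarnessLib

/-!
# A reduced chain of model `{111}` mirrors never maps the slots to the slots (NonReturn, model form)

HONEST FRAMING. Part of the venture `Summits/Ventures/Crystal3D` (cell `crystal3d-full`), helper for the
crux `CoaxialWallLaw` (stmt-Ventures-19481) of `route-Ventures-StickyWulffConstant`, REGISTERED line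
`WallLedgerF` (planner cf-p1 gen 16), open stub `stub_coaxialTwoSlabAdhesion` (general fillings).  Brick M2 of
the v2 (NET) line automaton (memo F-NET-AUTOMATON-v2 §7, evidence on the crux item): the transport of the
abstract 3-adic lemma `mirrorChain_not_mem` to the model lattice `Λ₀`.  Rung credit only; F-C1 not moved.

* `barlowPos_eq_zsum_slots` — `Λ₀` is the `ℤ`-span of the face `s₀, s₄, s₈` (cubic coordinates
  `(1,1,0), (1,0,1), (0,1,1)`): every site is `i s₀ + j s₄ + k s₈`;
* `faceSum_eq_sqrt6_smul` — for the far face `a, b, c` of a unit menu normal `μ`: `a + b + c = √6 μ`, hence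
  `√6 μ ∈ Λ₀` and `⟪w, √6 μ⟫ ∈ ℤ` for every site `w` (`sqrt6_smul_menuNormal_mem`, `inner_site_sqrt6_normal_int`);
* `foldl_reflect_slots_false` — for a non-empty list `κ` of unit menu normals of `Λ₀` with consecutive
  members at `⟪μ, μ'⟫ = ±1/3`, the composed reflection `x ↦ foldl (y ↦ y − 2⟪y, μ⟫ μ)` (head first) does NOT
  map `fccSlots` into `fccSlots` (it moves a far slot of the head off the lattice).

WHAT THIS IS NOT: not the stub; F-C1 not moved.
-/

noncomputable section

namespace Summit.Ventures.Crystal3D.Theorems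

open Summit.Ventures.Crystal3D Finset NearIdentity
open Literature.MathematicalPhysics.StatisticalMechanics (barlowPos barlowStacking fccStacking constHagg)
open Literature.Barriers.AtomisticToContinuum (barlowAddSubgroupOfConst)
open scoped InnerProductSpace

/-- **`Λ₀` is the `ℤ`-span of a face.**  The site `(k, i, j)` is `i s₀ + j s₄ + k s₈`. -/
theorem barlowPos_eq_zsum_slots (k i j : ℤ) :
    barlowPos 1 (Real.sqrt (2 / 3)) constHagg k i j =
      (i : ℝ) • slotSite 0 + (j : ℝ) • slotSite 4 + (k : ℝ) • slotSite 8 := by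
  apply cubicCoords_injective
  rw [cubicCoords_add, cubicCoords_add, cubicCoords_smul, cubicCoords_smul, cubicCoords_smul,
    cubicCoords_slotSite, cubicCoords_slotSite, cubicCoords_slotSite]
  obtain ⟨cA, cB, cC⟩ := cubic_barlowPos k i j
  unfold cubicCoords slotVec slotInt
  rw [cA, cB, cC]
  ext l
  fin_cases l <;> simp <;> ring

/-- Every site of `Λ₀` is an integer combination of the face `s₀, s₄, s₈`. -/
theorem exists_zsum_slots_of_mem_fcc {p : EuclideanSpace ℝ (Fin 3)} (hp : p ∈ fccStacking 1 (Real.sqrt (2 / 3))) :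
    ∃ i j k : ℤ, p = (i : ℝ) • slotSite 0 + (j : ℝ) • slotSite 4 + (k : ℝ) • slotSite 8 := by
  obtain ⟨k, i, j, rfl⟩ := hp
  exact ⟨i, j, k, barlowPos_eq_zsum_slots k i j⟩

/-- **The far face sums to `√6 μ`.** -/
theorem faceSum_eq_sqrt6_smul {μ a b c : EuclideanSpace ℝ (Fin 3)} (hμ : ‖μ‖ = 1)
    (ha : a ∈ fccSlots) (hb : b ∈ fccSlots) (hc : c ∈ fccSlots)
    (hna : ⟪a, μ⟫_ℝ = Real.sqrt (2 / 3)) (hnb : ⟪b, μ⟫_ℝ = Real.sqrt (2 / 3)) (hnc : ⟪c, μ⟫_ℝ = Real.sqrt (2 / 3))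
    (iab : ⟪a, b⟫_ℝ = 1 / 2) (iac : ⟪a, c⟫_ℝ = 1 / 2) (ibc : ⟪b, c⟫_ℝ = 1 / 2) :
    a + b + c = Real.sqrt 6 • μ := by
  have key : ∀ z, ⟪a + b + c - Real.sqrt 6 • μ, z⟫_ℝ = 0 := by
    intro z
    have h := sum_far_inner (LinearIsometryEquiv.refl ℝ (EuclideanSpace ℝ (Fin 3))) hμ ha hb hc
      (by simpa using hna) (by simpa using hnb) (by simpa using hnc) iab iac ibc z
    simp only [LinearIsometryEquiv.coe_refl, id] at h
    rw [inner_sub_left, inner_add_left, inner_add_left, real_inner_smul_left, h]; ring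
  have h0 : a + b + c - Real.sqrt 6 • μ = 0 := by
    rw [← inner_self_eq_zero (𝕜 := ℝ)]; exact key _
  exact sub_eq_zero.1 h0

/-- `√6 μ ∈ Λ₀` for a unit menu normal `μ`. -/
theorem sqrt6_smul_menuNormal_mem {μ : EuclideanSpace ℝ (Fin 3)} (hμ : ‖μ‖ = 1)
    (hmenu : ∀ w ∈ fccSlots, ⟪w, μ⟫_ℝ = 0 ∨ ⟪w, μ⟫_ℝ = Real.sqrt (2 / 3) ∨ ⟪w, μ⟫_ℝ = -Real.sqrt (2 / 3)) :
    Real.sqrt 6 • μ ∈ fccStacking 1 (Real.sqrt (2 / 3)) ∧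
    ∀ w ∈ fccStacking 1 (Real.sqrt (2 / 3)), ∃ z : ℤ, ⟪w, Real.sqrt 6 • μ⟫_ℝ = z := by
  have hmenu' : ∀ w ∈ fccSlots,
      ⟪(LinearIsometryEquiv.refl ℝ (EuclideanSpace ℝ (Fin 3))) w, μ⟫_ℝ = 0 ∨
      ⟪(LinearIsometryEquiv.refl ℝ (EuclideanSpace ℝ (Fin 3))) w, μ⟫_ℝ = Real.sqrt (2 / 3) ∨
      ⟪(LinearIsometryEquiv.refl ℝ (EuclideanSpace ℝ (Fin 3))) w, μ⟫_ℝ = -Real.sqrt (2 / 3) := by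
    intro w hw; simpa using hmenu w hw
  obtain ⟨a, ha, b, hb, c, hc, hna, hnb, hnc, iab, iac, ibc, -, -⟩ :=
    exists_far_frame (LinearIsometryEquiv.refl ℝ (EuclideanSpace ℝ (Fin 3))) hμ hmenu'
  simp only [LinearIsometryEquiv.coe_refl, id] at hna hnb hnc
  have hsum := faceSum_eq_sqrt6_smul hμ ha hb hc hna hnb hnc iab iac ibc
  rw [← hsum]
  refine ⟨fcc_add_site_mem (fcc_add_site_mem (mem_fcc_of_mem_fccSlots ha) (mem_fcc_of_mem_fccSlots hb))
    (mem_fcc_of_mem_fccSlots hc), ?_⟩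
  intro w hw
  -- integer values on the generating face, then on every site
  have hslot : ∀ s ∈ fccSlots, ∃ z : ℤ, ⟪s, a + b + c⟫_ℝ = z := by
    intro s hs
    rcases inner_faceSum_slot ha hb hc iab iac ibc hs with h | h | h
    · exact ⟨0, by rw [h]; simp⟩
    · exact ⟨2, by rw [h]; simp⟩
    · exact ⟨-2, by rw [h]; simp⟩
  obtain ⟨i, j, k, rfl⟩ := exists_zsum_slots_of_mem_fcc hw
  obtain ⟨z₀, h₀⟩ := hslot _ (slotSite_mem 0)
  obtain ⟨z₄, h₄⟩ := hslot _ (slotSite_mem 4)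
  obtain ⟨z₈, h₈⟩ := hslot _ (slotSite_mem 8)
  refine ⟨i * z₀ + j * z₄ + k * z₈, ?_⟩
  rw [inner_add_left, inner_add_left, real_inner_smul_left, real_inner_smul_left, real_inner_smul_left, h₀, h₄, h₈]
  push_cast; ring

/-- **NonReturn, model form.**  See the module docstring. -/
theorem foldl_reflect_slots_false (κ : List (EuclideanSpace ℝ (Fin 3))) (hne : κ ≠ [])
    (hμ : ∀ μ ∈ κ, ‖μ‖ = 1 ∧
      ∀ w ∈ fccSlots, ⟪w, μ⟫_ℝ = 0 ∨ ⟪w, μ⟫_ℝ = Real.sqrt (2 / 3) ∨ ⟪w, μ⟫_ℝ = -Real.sqrt (2 / 3))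
    (hchain : List.IsChain (fun μ μ' => ⟪μ, μ'⟫_ℝ = 1 / 3 ∨ ⟪μ, μ'⟫_ℝ = -1 / 3) κ)
    (hslots : ∀ w ∈ fccSlots,
      κ.foldl (fun (y : EuclideanSpace ℝ (Fin 3)) μ => y - (2 * ⟪y, μ⟫_ℝ) • μ) w ∈ fccSlots) : False := by
  obtain ⟨μ₁, κ', rfl⟩ := List.exists_cons_of_ne_nil hne
  have h6 : 0 < Real.sqrt 6 := Real.sqrt_pos.2 (by norm_num)
  have h66 : Real.sqrt 6 * Real.sqrt 6 = 6 := Real.mul_self_sqrt (by norm_num)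
  have hr : 0 < Real.sqrt (2 / 3) := Real.sqrt_pos.2 (by norm_num)
  have h6r : Real.sqrt 6 * Real.sqrt (2 / 3) = 2 := by
    rw [← Real.sqrt_mul (by norm_num)]
    rw [show (6 : ℝ) * (2 / 3) = 2 ^ 2 by norm_num, Real.sqrt_sq (by norm_num)]
  -- the lattice as a set with its closure properties
  set M : Set (EuclideanSpace ℝ (Fin 3)) := fccStacking 1 (Real.sqrt (2 / 3)) with hM
  set G₁ : AddSubgroup (EuclideanSpace ℝ (Fin 3)) :=
    barlowAddSubgroupOfConst 1 (Real.sqrt (2 / 3)) constHagg (fun _ => rfl) with hG₁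
  have hG₁mem : ∀ w, w ∈ G₁ ↔ w ∈ fccStacking 1 (Real.sqrt (2 / 3)) := fun w => Iff.rfl
  have hadd : ∀ x ∈ M, ∀ y ∈ M, x + y ∈ M := fun x hx y hy => fcc_add_site_mem hx hy
  have hzs : ∀ (z : ℤ), ∀ x ∈ M, (z : ℝ) • x ∈ M := by
    intro z x hx
    have := G₁.zsmul_mem ((hG₁mem x).2 hx) z
    rw [hG₁mem] at this
    rw [← Int.cast_smul_eq_zsmul ℝ] at this
    exact this
  have hint : ∀ w ∈ M, ∃ z : ℤ, ‖w‖ ^ 2 = z := fun w hw => exists_int_norm_sq_of_mem_fcc hw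
  -- the axes `√6 μ`
  set s : EuclideanSpace ℝ (Fin 3) → EuclideanSpace ℝ (Fin 3) := fun μ => Real.sqrt 6 • μ with hs
  set ts := κ'.reverse.map s with hts
  set tl := s μ₁ with htl
  have hlist : ts ++ [tl] = (μ₁ :: κ').reverse.map s := by
    rw [hts, htl, List.reverse_cons, List.map_append, List.map_singleton]
  have haxes : ∀ t ∈ ts ++ [tl], t ∈ M ∧ ∀ w ∈ M, ∃ z : ℤ, ⟪w, t⟫_ℝ = z := by
    intro t ht
    rw [hlist, List.mem_map] at ht
    obtain ⟨μ, hμm, rfl⟩ := ht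
    rw [List.mem_reverse] at hμm
    obtain ⟨hn, hmn⟩ := hμ μ hμm
    exact sqrt6_smul_menuNormal_mem hn hmn
  have hchain' : List.IsChain (fun t t' => ⟪t, t'⟫_ℝ = 2 ∨ ⟪t, t'⟫_ℝ = -2) (ts ++ [tl]) := by
    have hrev : List.IsChain (fun μ μ' : EuclideanSpace ℝ (Fin 3) => ⟪μ, μ'⟫_ℝ = 1 / 3 ∨ ⟪μ, μ'⟫_ℝ = -1 / 3)
        (μ₁ :: κ').reverse := by
      rw [List.isChain_reverse]
      exact hchain.imp fun a b h => by rw [real_inner_comm]; exact h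
    have hmap := List.isChain_map_of_isChain (R := fun μ μ' : EuclideanSpace ℝ (Fin 3) =>
        ⟪μ, μ'⟫_ℝ = 1 / 3 ∨ ⟪μ, μ'⟫_ℝ = -1 / 3)
      (S := fun t t' : EuclideanSpace ℝ (Fin 3) => ⟪t, t'⟫_ℝ = 2 ∨ ⟪t, t'⟫_ℝ = -2) s (fun a b h => by
        show ⟪s a, s b⟫_ℝ = 2 ∨ ⟪s a, s b⟫_ℝ = -2
        rw [hs]
        simp only [real_inner_smul_left, real_inner_smul_right]
        rcases h with h | h <;> rw [h]
        · left; nlinarith [h66]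
        · right; nlinarith [h66]) hrev
    rw [hlist]; exact hmap
  have hnorm : ‖(ts ++ [tl]).headD tl‖ ^ 2 = 6 := by
    have hall : ∀ t ∈ ts ++ [tl], ‖t‖ ^ 2 = 6 := by
      intro t ht
      rw [hlist, List.mem_map] at ht
      obtain ⟨μ, hμm, rfl⟩ := ht
      rw [List.mem_reverse] at hμm
      rw [hs, norm_smul, (hμ μ hμm).1, mul_one, Real.norm_eq_abs, abs_of_pos h6, sq, h66]
    cases hc : ts with
    | nil => exact hall tl (by simp)
    | cons t rest => exact hall t (by rw [hc]; simp)
  -- a far slot of the head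
  obtain ⟨hn₁, hmn₁⟩ := hμ μ₁ (by simp)
  have hmenu₁ : ∀ w ∈ fccSlots,
      ⟪(LinearIsometryEquiv.refl ℝ (EuclideanSpace ℝ (Fin 3))) w, μ₁⟫_ℝ = 0 ∨
      ⟪(LinearIsometryEquiv.refl ℝ (EuclideanSpace ℝ (Fin 3))) w, μ₁⟫_ℝ = Real.sqrt (2 / 3) ∨
      ⟪(LinearIsometryEquiv.refl ℝ (EuclideanSpace ℝ (Fin 3))) w, μ₁⟫_ℝ = -Real.sqrt (2 / 3) := by
    intro w hw; simpa using hmn₁ w hw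
  obtain ⟨u, hu, -, -, -, -, hun, -⟩ := exists_far_frame (LinearIsometryEquiv.refl ℝ _) hn₁ hmenu₁
  simp only [LinearIsometryEquiv.coe_refl, id] at hun
  have hut : ⟪u, tl⟫_ℝ = 2 ∨ ⟪u, tl⟫_ℝ = -2 := by
    left; rw [htl, hs]; simp only [real_inner_smul_right]; rw [hun, h6r]
  have key := mirrorChain_not_mem M hadd hzs hint ts tl haxes hchain' hnorm (mem_fcc_of_mem_fccSlots hu) hut
  -- the abstract chain is the composed reflection
  have hgen : ∀ (l : List (EuclideanSpace ℝ (Fin 3))) (v : EuclideanSpace ℝ (Fin 3)),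
      (l.map s).foldr (fun t (x : EuclideanSpace ℝ (Fin 3)) => x - (⟪x, t⟫_ℝ / 3) • t) v =
        l.foldr (fun μ (x : EuclideanSpace ℝ (Fin 3)) => x - (2 * ⟪x, μ⟫_ℝ) • μ) v := by
    intro l v
    induction l with
    | nil => rfl
    | cons μ l ih =>
      simp only [List.map_cons, List.foldr_cons, ih]
      rw [hs]
      simp only [real_inner_smul_right, smul_smul]
      congr 2
      have : Real.sqrt 6 * ⟪List.foldr (fun μ x => x - (2 * ⟪x, μ⟫_ℝ) • μ) v l, μ⟫_ℝ / 3 * Real.sqrt 6 =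
          Real.sqrt 6 * Real.sqrt 6 / 3 * ⟪List.foldr (fun μ x => x - (2 * ⟪x, μ⟫_ℝ) • μ) v l, μ⟫_ℝ := by ring
      rw [this, h66]; ring
  have hfold : (ts ++ [tl]).foldr (fun t (x : EuclideanSpace ℝ (Fin 3)) => x - (⟪x, t⟫_ℝ / 3) • t) u =
      (μ₁ :: κ').foldl (fun (y : EuclideanSpace ℝ (Fin 3)) μ => y - (2 * ⟪y, μ⟫_ℝ) • μ) u := by
    rw [hlist, hgen, List.foldr_reverse]
  rw [hfold] at key
  exact key (mem_fcc_of_mem_fccSlots (hslots u hu))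

end Summit.Ventures.Crystal3D.Theorems

end
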